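import Summits.CriticalPhenomena.PercolationContinuityZ3.Theorems.Transplant.FKConnectivityAllQPat3KNetTheoremSP
import Summits.CriticalPhenomena.PercolationContinuityZ3.Theorems.Transplant.FKConnectivityAllQPat3KNetOps
import HarnessLib

/-!
# Connectivity correlation inequalities for `φ_{w,q}`, every `q > 0` — **`δ ≥ 0` AND THE HUB INEQUALITY FOR EVERY PLACEMENT ON BRIDGE–SERIES–PARALLEL SUPPORTS (class 𝒦, `K₄ ∈ 𝒦`)**

Proof file (`--supports stmt-CriticalPhenomena-4575`), census lineage (gen 42) of LANE 2's FK sub-programme; builds on p205010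
(kernel theorem, internal audit signed; external expert review pending).  No definitions, no named facts, no sorries.

The MEASURE-LEVEL consequence of census g41's THEOREM SP(𝒦) (`FK.spGoodC_of_isKNet`, `…Pat3KNetTheoremSP.lean`: every minor of
every bridge–series–parallel network `N` — `FK.IsKNet N x y`, the least two-terminal class closed under edge / SERIES / PARALLEL /
BRIDGE = Wheatstone bridge `K₄ − xy` with 𝒦-networks in its five slots, «Pat3KNetDefs» — is SP-good at every three pairwise distinct
marks) through the local form of `…Pat3SPConjecture.lean` (`FK.deltaMass_nonneg_of_spGood_support`, `FK.hubUnder_of_spGood_support`,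
`FK.real_conn_union_le_of_spGood_support`: SP-goodness of the minors of the support suffices).  This is census g37's
`…Pat3DeltaSP.lean` ONE RUNG UP: `FK.IsTTSP N x y → FK.IsKNet N x y` (`FK.IsTTSP.isKNet`) and `K₄ ∈ 𝒦` (`FK.isKNet_K4`), so the
two-terminal series–parallel rows are the special case and `K₄` supports are newly covered.  RESULTS, for every `q > 0` and every
weight vector `w` supported in a 𝒦-network `N`: for pairwise distinct `b, s, t` on `N` — `δ_w(b; s, t) ≥ 0`
(`FK.deltaMass_nonneg_of_isKNet_marks`), the HUB INEQUALITY ALR (13)/(14) `φ(b ↔ s)·φ(t ↔ s) ≤ φ(b ↔ s ↔ t)`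
(`FK.hubUnder_of_isKNet_marks`) and the sharper correlation of `{s ↔ t}` with `{b ↔ s} ∪ {b ↔ t}`
(`FK.real_conn_union_le_of_isKNet_marks`); for ALL triples `o, a, b : V` (degenerate ones via `…DeltaSupport.lean`) —
`FK.hubUnder_of_isKNet_support`, `FK.hubFK_of_isKNet_support` (`HubFK q`'s clause verbatim on 𝒦 supports),
`FK.real_conn_union_le_of_isKNet_support`; and, as the first non-series–parallel instance, EVERY weight vector supported in a `K₄`
(`FK.hubUnder_of_K4_support`, `FK.real_conn_union_le_of_K4_support`, `FK.deltaMass_nonneg_of_K4_support`).  Beyond 𝒦 (the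
`W₄`-minor-free two-terminal class) the hub inequality for `q < 1` is OPEN (Grimmett 2006 §3.9; census evidence `FK.SPGoodPos`).
[cite: AyyerLinussonRavichandran2025, §7 eq. (13)–(15), Conj. 7.1 (p. 22)] [cite: Grimmett2006, §3.8 (pp. 61–62); §3.9 (p. 63)]
-/

namespace Summit.CriticalPhenomena.PercolationContinuityZ3.Theorems

namespace FK

open MeasureTheory Set Literature.Probability.LatticeModels Literature.Probability.Percolation
open scoped Classical

variable {V : Type*} [Fintype V] (w : Sym2 V → unitInterval)

/-! ### Distinct marks on the support -/

/-- **NEW KERNEL ROW (census g41/g42): `δ_w(b; s, t) ≥ 0` FOR EVERY WEIGHT VECTOR SUPPORTED IN A BRIDGE–SERIES–PARALLEL NETWORK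
(class 𝒦) AND EVERY THREE DISTINCT MARKS ON IT, every `q > 0`.** [cite: AyyerLinussonRavichandran2025, §7 eq. (13)–(15) (p. 22)] -/
theorem deltaMass_nonneg_of_isKNet_marks {q : ℝ} (hq : 0 < q) {N : Finset (Sym2 V)} {x y b s t : V} (hN : IsKNet N x y)
    (hw : ∀ e, ((w e : unitInterval) : ℝ) ≠ 0 → e ∈ (↑N : Set (Sym2 V)))
    (hb : ∃ e ∈ N, b ∈ e) (hs : ∃ e ∈ N, s ∈ e) (ht : ∃ e ∈ N, t ∈ e) (hbs : b ≠ s) (hbt : b ≠ t) (hst : s ≠ t) :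
    0 ≤ deltaMass w q b s t :=
  deltaMass_nonneg_of_spGood_support w hq (fun _ _ hE hC _ _ _ => spGoodC_of_isKNet hN hE hC) hw hb hs ht hbs hbt hst

/-- **THE HUB INEQUALITY ALR (13)/(14) FOR EVERY PLACEMENT OF DISTINCT MARKS ON A BRIDGE–SERIES–PARALLEL SUPPORT, every
`q > 0`**: `φ(b ↔ s)·φ(t ↔ s) ≤ φ(b ↔ s ↔ t)` (`FK.HubUnder`; hub `s`). [cite: AyyerLinussonRavichandran2025, §7 eq. (13)–(14), Conj. 7.1 (p. 22)] -/
theorem hubUnder_of_isKNet_marks {q : ℝ} (hq : 0 < q) {N : Finset (Sym2 V)} {x y b s t : V} (hN : IsKNet N x y)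
    (hw : ∀ e, ((w e : unitInterval) : ℝ) ≠ 0 → e ∈ (↑N : Set (Sym2 V)))
    (hb : ∃ e ∈ N, b ∈ e) (hs : ∃ e ∈ N, s ∈ e) (ht : ∃ e ∈ N, t ∈ e) (hbs : b ≠ s) (hbt : b ≠ t) (hst : s ≠ t) :
    HubUnder (rcMeasureW w q ∅) b s t :=
  hubUnder_of_deltaMass_nonneg w hq (deltaMass_nonneg_of_isKNet_marks w hq hN hw hb hs ht hbs hbt hst)

/-- **The sharper correlation on bridge–series–parallel supports, distinct marks, every `q > 0`**:
`φ(s ↔ t)·φ(b ↔ {s,t}) ≤ φ(Ω)·φ(s ↔ t, b ↔ {s,t})`. [cite: AyyerLinussonRavichandran2025, §7 (p. 22)] -/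
theorem real_conn_union_le_of_isKNet_marks {q : ℝ} (hq : 0 < q) {N : Finset (Sym2 V)} {x y b s t : V} (hN : IsKNet N x y)
    (hw : ∀ e, ((w e : unitInterval) : ℝ) ≠ 0 → e ∈ (↑N : Set (Sym2 V)))
    (hb : ∃ e ∈ N, b ∈ e) (hs : ∃ e ∈ N, s ∈ e) (ht : ∃ e ∈ N, t ∈ e) (hbs : b ≠ s) (hbt : b ≠ t) (hst : s ≠ t) :
    (rcMeasureW w q ∅).real (openConn s t) * (rcMeasureW w q ∅).real (openConn b s ∪ openConn b t) ≤
      (rcMeasureW w q ∅).real univ * (rcMeasureW w q ∅).real (openConn s t ∩ (openConn b s ∪ openConn b t)) :=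
  real_conn_union_le_of_deltaMass_nonneg w hq (deltaMass_nonneg_of_isKNet_marks w hq hN hw hb hs ht hbs hbt hst)

/-! ### All triples of vertices -/

/-- **THE HUB INEQUALITY FOR ALL TRIPLES OF VERTICES ON BRIDGE–SERIES–PARALLEL SUPPORTS, every `q > 0`**:
`φ_{w,q}(o ↔ a)·φ_{w,q}(b ↔ a) ≤ φ_{w,q}(o ↔ a ↔ b)` for EVERY `o, a, b : V` once `w` is supported in a 𝒦-network `N`
(census g37's `FK.hubUnder_of_isTTSP_support` one rung up). [cite: AyyerLinussonRavichandran2025, §7 eq. (13)–(14), Conj. 7.1 (p. 22)] -/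
theorem hubUnder_of_isKNet_support {q : ℝ} (hq : 0 < q) {N : Finset (Sym2 V)} {x y : V} (hN : IsKNet N x y)
    (hw : ∀ e, ((w e : unitInterval) : ℝ) ≠ 0 → e ∈ (↑N : Set (Sym2 V))) (o a b : V) :
    HubUnder (rcMeasureW w q ∅) o a b :=
  hubUnder_of_spGood_support w hq (fun _ _ hE hC _ _ _ => spGoodC_of_isKNet hN hE hC) hw o a b

/-- **`HubFK`-shaped corollary**: for every `q > 0`, every `n` and every weight vector on `Fin n` supported in a bridge–series–parallel
network, the hub inequality holds at every triple (the clause of `FK.HubFK q` restricted to 𝒦 supports).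
[cite: AyyerLinussonRavichandran2025, §7 eq. (13)–(14), Conj. 7.1 (p. 22)] -/
theorem hubFK_of_isKNet_support {q : ℝ} (hq : 0 < q) (n : ℕ) (w' : Sym2 (Fin n) → unitInterval) {N : Finset (Sym2 (Fin n))}
    {x y : Fin n} (hN : IsKNet N x y) (hw : ∀ e, ((w' e : unitInterval) : ℝ) ≠ 0 → e ∈ (↑N : Set (Sym2 (Fin n))))
    (o a b : Fin n) : HubUnder (rcMeasureW w' q ∅) o a b :=
  hubUnder_of_isKNet_support w' hq hN hw o a b

/-- **The sharper correlation for ALL triples on bridge–series–parallel supports, every `q > 0`**: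
`φ(s ↔ t)·φ(b ↔ {s,t}) ≤ φ(Ω)·φ(s ↔ t, b ↔ {s,t})` for every `b, s, t : V`. [cite: AyyerLinussonRavichandran2025, §7 (p. 22)] -/
theorem real_conn_union_le_of_isKNet_support {q : ℝ} (hq : 0 < q) {N : Finset (Sym2 V)} {x y : V} (hN : IsKNet N x y)
    (hw : ∀ e, ((w e : unitInterval) : ℝ) ≠ 0 → e ∈ (↑N : Set (Sym2 V))) (b s t : V) :
    (rcMeasureW w q ∅).real (openConn s t) * (rcMeasureW w q ∅).real (openConn b s ∪ openConn b t) ≤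
      (rcMeasureW w q ∅).real univ * (rcMeasureW w q ∅).real (openConn s t ∩ (openConn b s ∪ openConn b t)) :=
  real_conn_union_le_of_spGood_support w hq (fun _ _ hE hC _ _ _ => spGoodC_of_isKNet hN hE hC) hw b s t

/-! ### The first non-series–parallel supports: every weight vector on a `K₄` -/

section K4

variable {a b c d : V}

/-- **`δ_w(z; s, t) ≥ 0` FOR EVERY WEIGHT VECTOR SUPPORTED IN A `K₄`, every three distinct marks among its vertices' edges, every
`q > 0`** (`K₄ ∈ 𝒦`: `FK.isKNet_K4`; `K₄` is not series–parallel, so this row is outside `…Pat3DeltaSP.lean` / `…Pat3NoK4Minor.lean`).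
[cite: AyyerLinussonRavichandran2025, §7 eq. (13)–(15) (p. 22)] -/
theorem deltaMass_nonneg_of_K4_support {q : ℝ} (hq : 0 < q) (hab : a ≠ b) (hac : a ≠ c) (had : a ≠ d) (hbc : b ≠ c)
    (hbd : b ≠ d) (hcd : c ≠ d)
    (hw : ∀ e, ((w e : unitInterval) : ℝ) ≠ 0 →
      e ∈ (↑({s(a, b)} ∪ ({s(a, c)} ∪ {s(a, d)} ∪ {s(b, c)} ∪ {s(b, d)} ∪ {s(c, d)}) : Finset (Sym2 V)) : Set (Sym2 V)))
    {z s t : V} (hz : ∃ e ∈ ({s(a, b)} ∪ ({s(a, c)} ∪ {s(a, d)} ∪ {s(b, c)} ∪ {s(b, d)} ∪ {s(c, d)}) : Finset (Sym2 V)), z ∈ e)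
    (hs : ∃ e ∈ ({s(a, b)} ∪ ({s(a, c)} ∪ {s(a, d)} ∪ {s(b, c)} ∪ {s(b, d)} ∪ {s(c, d)}) : Finset (Sym2 V)), s ∈ e)
    (ht : ∃ e ∈ ({s(a, b)} ∪ ({s(a, c)} ∪ {s(a, d)} ∪ {s(b, c)} ∪ {s(b, d)} ∪ {s(c, d)}) : Finset (Sym2 V)), t ∈ e)
    (hzs : z ≠ s) (hzt : z ≠ t) (hst : s ≠ t) : 0 ≤ deltaMass w q z s t :=
  deltaMass_nonneg_of_isKNet_marks w hq (isKNet_K4 hab hac had hbc hbd hcd) hw hz hs ht hzs hzt hst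

/-- **THE HUB INEQUALITY AT EVERY TRIPLE FOR EVERY WEIGHT VECTOR SUPPORTED IN A `K₄`, every `q > 0`**:
`φ_{w,q}(o ↔ u)·φ_{w,q}(v ↔ u) ≤ φ_{w,q}(o ↔ u ↔ v)` for every `o, u, v : V`.
[cite: AyyerLinussonRavichandran2025, §7 eq. (13)–(14), Conj. 7.1 (p. 22)] -/
theorem hubUnder_of_K4_support {q : ℝ} (hq : 0 < q) (hab : a ≠ b) (hac : a ≠ c) (had : a ≠ d) (hbc : b ≠ c) (hbd : b ≠ d)
    (hcd : c ≠ d)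
    (hw : ∀ e, ((w e : unitInterval) : ℝ) ≠ 0 →
      e ∈ (↑({s(a, b)} ∪ ({s(a, c)} ∪ {s(a, d)} ∪ {s(b, c)} ∪ {s(b, d)} ∪ {s(c, d)}) : Finset (Sym2 V)) : Set (Sym2 V)))
    (o u v : V) : HubUnder (rcMeasureW w q ∅) o u v :=
  hubUnder_of_isKNet_support w hq (isKNet_K4 hab hac had hbc hbd hcd) hw o u v

/-- **The sharper correlation at every triple for every weight vector supported in a `K₄`, every `q > 0`.**
[cite: AyyerLinussonRavichandran2025, §7 (p. 22)] -/
theorem real_conn_union_le_of_K4_support {q : ℝ} (hq : 0 < q) (hab : a ≠ b) (hac : a ≠ c) (had : a ≠ d) (hbc : b ≠ c)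
    (hbd : b ≠ d) (hcd : c ≠ d)
    (hw : ∀ e, ((w e : unitInterval) : ℝ) ≠ 0 →
      e ∈ (↑({s(a, b)} ∪ ({s(a, c)} ∪ {s(a, d)} ∪ {s(b, c)} ∪ {s(b, d)} ∪ {s(c, d)}) : Finset (Sym2 V)) : Set (Sym2 V)))
    (z s t : V) :
    (rcMeasureW w q ∅).real (openConn s t) * (rcMeasureW w q ∅).real (openConn z s ∪ openConn z t) ≤
      (rcMeasureW w q ∅).real univ * (rcMeasureW w q ∅).real (openConn s t ∩ (openConn z s ∪ openConn z t)) :=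
  real_conn_union_le_of_isKNet_support w hq (isKNet_K4 hab hac had hbc hbd hcd) hw z s t

end K4

end FK

end Summit.CriticalPhenomena.PercolationContinuityZ3.Theorems
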